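import Mathlib
import Summits.Ventures.PercRepro2.TypedCountDeletion

/-!
# The contracted typed count: the base case and the induction principle
(blind cell PercRepro2, night-3 g25, 2026-08-29; `proofs/NIGHT3-CERT.md` §34.2, §34.7)

With `T(S, C)` the contracted typed count of `TypedCountDeletion.lean` (free edges `S`, contracted
edges `C`, weight the unmerged cluster of `s`), write `K_z` for the `C`-cluster of a vertex `z`
(`cclus`) and call a free edge `e` **safe** when `v` stays outside the `C ∪ e`-cluster of `s`
(merging the ends of `e` does not join the source block to `v`).

* **`typedCount_nonneg_of_no_safe`** — the base case: if `v ∉ K_s` and no free edge is safe (every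
  one joins `K_s` to `K_v`), both clusters of every colouring lie in `{K_s, K_s ∪ K_v}`
  (`cluster_withC_two_values`), so every term is a product of two like-signed differences and
  `T(S, C) ≥ 0`;
* **`typedCount_nonneg_of_step`** — the induction principle: if `T(S, C) ≥ T(S ∖ e, C)` at every
  safe free edge `e` (the step (M′) of §34.7), then `T(S, C) ≥ 0` whenever `v ∉ K_s` — a valid
  reduction whose hypothesis turns out to be false (below);
* **`typedCount_empty_nonneg_of_step`** — in particular the typed point-split count `T(S, ∅) ≥ 0`.

The step (M′) is exhaustively true at `n = 4` for every safe edge (1,444,843,008 up-set-pair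
tests, §34.7) but **FALSE at `n = 5`** (§34.9: the contracted count itself can be negative there,
`TypedCountContractedNeg.exists_contracted_neg_v_outside`), so the hypothesis of the induction
principle fails and this route is closed; the file records the exact shape a successful
strengthening must have (the step with the merged weight is `T(H/e)` plus a defect).  Own work;
standard axioms.
-/

namespace Summit.Ventures.PercRepro2

namespace TypedDeletion

variable {V : Type*} {E : Type*}

/-! ## The base case: no safe edge -/

section Base

variable [DecidableEq E]

/-- The `C`-cluster of `z`: the cluster in the configuration with exactly the edges of `C` open. -/
def cclus (ends : E → Sym2 V) (C : Finset E) (z : V) : Set V := cluster ends (withC C (fun _ => false)) z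

/-- An edge of `C` is open in `1_C`. -/
lemma withC_zero_of_mem {C : Finset E} {e : E} (he : e ∈ C) :
    withC C (fun _ => false) e = true := by simp [withC_apply, he]

omit [DecidableEq E] in
/-- The ends of an edge, as a pair. -/
lemma exists_ends (ends : E → Sym2 V) (e : E) : ∃ x y, ends e = s(x, y) :=
  Sym2.inductionOn (ends e) (fun x y => ⟨x, y, rfl⟩)

omit [DecidableEq E] in
/-- A vertex of the cluster of `z` has the same cluster. -/
lemma cluster_eq_of_mem {ends : E → Sym2 V} {ω : Config E} {z y : V} (hy : y ∈ cluster ends ω z) :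
    cluster ends ω y = cluster ends ω z := by
  ext u
  simp only [mem_cluster] at hy ⊢
  exact ⟨fun h => conn_trans hy h, fun h => conn_trans (conn_symm hy) h⟩

omit [DecidableEq E] in
/-- Closure of a set under the open adjacency of `ω`, via a closed-edge criterion: every open edge
with an endpoint in `T` has both endpoints in `T`. -/
lemma cluster_subset_of_closed {ends : E → Sym2 V} {ω : Config E} {T : Set V} {z : V} (hz : z ∈ T)
    (hT : ∀ e x y, ω e = true → ends e = s(x, y) → x ∈ T → y ∈ T) :
    cluster ends ω z ⊆ T := by
  intro u hu
  refine mem_of_conn_of_closed ?_ hz hu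
  intro x hx y hxy
  rw [openGraph_adj] at hxy
  obtain ⟨_, e, he, hends⟩ := hxy
  exact hT e x y he hends hx

/-- The `C`-clusters are closed under the edges of `C`. -/
lemma cclus_closed {ends : E → Sym2 V} {C : Finset E} {z : V} {e : E} {x y : V} (he : e ∈ C)
    (hends : ends e = s(x, y)) (hx : x ∈ cclus ends C z) : y ∈ cclus ends C z := by
  by_cases hxy : x = y
  · subst hxy; exact hx
  · exact mem_cluster_of_adj hx (openGraph_adj.2 ⟨hxy, e, withC_zero_of_mem he, hends⟩)

/-- Two `C`-clusters are equal or disjoint: if `v ∉ K_s` then `K_s ∩ K_v = ∅`. -/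
lemma cclus_disjoint {ends : E → Sym2 V} {C : Finset E} {s v : V} (hv : v ∉ cclus ends C s) {u : V}
    (hu : u ∈ cclus ends C s) : u ∉ cclus ends C v := by
  intro huv
  apply hv
  simp only [cclus, mem_cluster] at hu huv ⊢
  exact conn_trans hu (conn_symm huv)

/-- **An unsafe edge joins `K_s` to `K_v`**: if `v ∉ K_s` but `v` is in the `C ∪ e`-cluster of `s`,
the ends of `e` are one in `K_s` and one in `K_v`. -/
lemma unsafe_ends {ends : E → Sym2 V} {C : Finset E} {s v : V} (hv : v ∉ cclus ends C s) {e : E}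
    (hu : v ∈ cluster ends (withC (insert e C) (fun _ => false)) s) :
    ∃ x y, ends e = s(x, y) ∧ x ∈ cclus ends C s ∧ y ∈ cclus ends C v := by
  obtain ⟨x, y, hxy⟩ := exists_ends ends e
  -- the open edges of `1_{C ∪ e}` are those of `C` and `e`
  have hopen : ∀ e', withC (insert e C) (fun _ => false) e' = true → e' = e ∨ e' ∈ C := by
    intro e' h
    simp only [withC_apply, Bool.false_or, decide_eq_true_eq, Finset.mem_insert] at h
    exact h
  -- some end of `e` lies in `K_s`, else `K_s` is closed in `1_{C ∪ e}`
  have hK : x ∈ cclus ends C s ∨ y ∈ cclus ends C s := by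
    by_contra hcon
    have hcon : x ∉ cclus ends C s ∧ y ∉ cclus ends C s := not_or.mp hcon
    have hsub : cluster ends (withC (insert e C) (fun _ => false)) s ⊆ cclus ends C s := by
      refine cluster_subset_of_closed (mem_cluster_self _ _ _) ?_
      intro e' a b he' hab ha
      rcases hopen e' he' with rfl | he'C
      · rw [hxy] at hab
        rcases Sym2.eq_iff.1 hab with ⟨rfl, rfl⟩ | ⟨rfl, rfl⟩
        · exact absurd ha hcon.1
        · exact absurd ha hcon.2
      · exact cclus_closed he'C hab ha
    exact hv (hsub hu)
  -- the other end lies in `K_v`: `K_s ∪ K_other` is closed in `1_{C ∪ e}`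
  have key : ∀ a b, ends e = s(a, b) → a ∈ cclus ends C s → b ∈ cclus ends C v := by
    intro a b hab ha
    have hsub : cluster ends (withC (insert e C) (fun _ => false)) s ⊆
        cclus ends C s ∪ cclus ends C b := by
      refine cluster_subset_of_closed (Or.inl (mem_cluster_self _ _ _)) ?_
      intro e' p q he' hpq hp
      rcases hopen e' he' with rfl | he'C
      · rw [hab] at hpq
        rcases Sym2.eq_iff.1 hpq with ⟨rfl, rfl⟩ | ⟨rfl, rfl⟩
        · exact Or.inr (mem_cluster_self _ _ _)
        · exact Or.inl ha
      · rcases hp with hp | hp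
        · exact Or.inl (cclus_closed he'C hpq hp)
        · exact Or.inr (cclus_closed he'C hpq hp)
    rcases hsub hu with h | h
    · exact absurd h hv
    · simp only [cclus, mem_cluster] at h ⊢
      exact conn_symm h
  rcases hK with hx | hy
  · exact ⟨x, y, hxy, hx, key x y hxy hx⟩
  · exact ⟨y, x, by rw [hxy, Sym2.eq_swap], hy, key y x (by rw [hxy, Sym2.eq_swap]) hy⟩

/-- **The two-value lemma**: if `v ∉ K_s` and every edge of `S` is unsafe, the cluster of `s` in
`ω ⊔ 1_C` is `K_s` or `K_s ∪ K_v` for every `ω` supported on `S`. -/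
lemma cluster_withC_two_values {ends : E → Sym2 V} {C S : Finset E} {s v : V}
    (hv : v ∉ cclus ends C s)
    (hns : ∀ e ∈ S, v ∈ cluster ends (withC (insert e C) (fun _ => false)) s)
    {ω : Config E} (hω : OnS S ω) :
    cluster ends (withC C ω) s = cclus ends C s ∨
      cluster ends (withC C ω) s = cclus ends C s ∪ cclus ends C v := by
  have hK : cclus ends C s ⊆ cluster ends (withC C ω) s :=
    cluster_mono (withC_mono C (fun _ => Bool.false_le _)) s
  have hsub : cluster ends (withC C ω) s ⊆ cclus ends C s ∪ cclus ends C v := by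
    refine cluster_subset_of_closed (Or.inl (mem_cluster_self _ _ _)) ?_
    intro e' p q he' hpq hp
    simp only [withC_apply, Bool.or_eq_true, decide_eq_true_eq] at he'
    rcases he' with he' | he'
    · -- a free open edge: unsafe, so it joins `K_s` and `K_v`
      obtain ⟨x, y, hxy, hx, hy⟩ := unsafe_ends hv (hns e' (hω e' he'))
      rw [hxy] at hpq
      rcases Sym2.eq_iff.1 hpq with ⟨rfl, rfl⟩ | ⟨rfl, rfl⟩
      · exact Or.inr hy
      · exact Or.inl hx
    · rcases hp with hp | hp
      · exact Or.inl (cclus_closed he' hpq hp)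
      · exact Or.inr (cclus_closed he' hpq hp)
  by_cases hzero : ∀ e, ω e = false
  · left
    have : withC C ω = withC C (fun _ => false) := by
      funext e; simp [withC_apply, hzero e]
    rw [this]; rfl
  · right
    obtain ⟨e, he⟩ := not_forall.mp hzero
    have he1 : ω e = true := by simpa using he
    obtain ⟨x, y, hxy, hx, hy⟩ := unsafe_ends hv (hns e (hω e he1))
    refine Set.Subset.antisymm hsub (Set.union_subset hK ?_)
    -- `y ∈ K_v` is adjacent to `x ∈ K_s ⊆ R`, so `K_v = K_y ⊆ R`
    have hxR : x ∈ cluster ends (withC C ω) s := hK hx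
    have hne : x ≠ y := fun h => cclus_disjoint hv hx (h ▸ hy)
    have hyR : y ∈ cluster ends (withC C ω) s :=
      mem_cluster_of_adj hxR (openGraph_adj.2 ⟨hne, e, by simp [withC_apply, he1], hxy⟩)
    have hKv : cclus ends C v = cclus ends C y := (cluster_eq_of_mem hy).symm
    rw [hKv]
    calc cclus ends C y ⊆ cluster ends (withC C ω) y :=
          cluster_mono (withC_mono C (fun _ => Bool.false_le _)) y
      _ = cluster ends (withC C ω) s := cluster_eq_of_mem hyR

end Base


/-! ## The induction principle -/

section Induction

variable [Fintype E] [DecidableEq E] {R : Type*} [Field R] [LinearOrder R] [IsStrictOrderedRing R]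

omit [Fintype E] [DecidableEq E] in
/-- The cluster difference is nonnegative on comparable sets. -/
lemma dlt_nonneg_of_comparable {F G : Set V → R} (hF : Monotone F) (hG : Monotone G) {P Q : Set V}
    (h : P ⊆ Q ∨ Q ⊆ P) : 0 ≤ dlt F G P Q := by
  unfold dlt
  rcases h with h | h
  · exact mul_nonneg_of_nonpos_of_nonpos (sub_nonpos.mpr (hF h)) (sub_nonpos.mpr (hG h))
  · exact mul_nonneg (sub_nonneg.mpr (hF h)) (sub_nonneg.mpr (hG h))

omit [Fintype E] in
/-- The complement within `S` is supported on `S`. -/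
lemma onS_flipOn (S : Finset E) (ω : Config E) : OnS S (flipOn S ω) := by
  intro e he
  simp only [flipOn_apply, Bool.and_eq_true, decide_eq_true_eq] at he
  exact he.1

/-- **The base case**: if `v ∉ K_s` and no free edge is safe, `T(S, C) ≥ 0`. -/
theorem typedCount_nonneg_of_no_safe (ends : E → Sym2 V) (s v : V) {F G : Set V → R}
    (hF : Monotone F) (hG : Monotone G) (S C : Finset E) (hv : v ∉ cclus ends C s)
    (hns : ∀ e ∈ S, v ∈ cluster ends (withC (insert e C) (fun _ => false)) s) :
    0 ≤ typedCount ends s v F G S C := by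
  classical
  unfold typedCount
  apply Finset.sum_nonneg
  intro ω _
  split_ifs with hω
  · have hw : (0 : R) ≤ wt ends s v ω := by
      unfold wt; split_ifs <;> norm_num
    refine mul_nonneg hw (dlt_nonneg_of_comparable hF hG ?_)
    rcases cluster_withC_two_values hv hns hω with h1 | h1 <;>
      rcases cluster_withC_two_values hv hns (onS_flipOn S ω) with h2 | h2 <;>
      rw [h1, h2]
    · exact Or.inl le_rfl
    · exact Or.inl Set.subset_union_left
    · exact Or.inr Set.subset_union_left
    · exact Or.inl le_rfl
  · exact le_rfl

/-- **The induction principle**: if `T(S, C) ≥ T(S ∖ e, C)` at every safe free edge `e` (the step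
(M′) of §34.7), then `T(S, C) ≥ 0` whenever `v ∉ K_s`. -/
theorem typedCount_nonneg_of_step (ends : E → Sym2 V) (s v : V) {F G : Set V → R}
    (hF : Monotone F) (hG : Monotone G)
    (hstep : ∀ (S C : Finset E) (e : E), e ∈ S →
      v ∉ cluster ends (withC (insert e C) (fun _ => false)) s →
      typedCount ends s v F G (S.erase e) C ≤ typedCount ends s v F G S C) :
    ∀ (S C : Finset E), v ∉ cclus ends C s → 0 ≤ typedCount ends s v F G S C := by
  intro S
  refine Finset.strongInductionOn S ?_
  intro S ih C hv
  by_cases h : ∃ e ∈ S, v ∉ cluster ends (withC (insert e C) (fun _ => false)) s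
  · obtain ⟨e, he, hsafe⟩ := h
    exact le_trans (ih (S.erase e) (Finset.erase_ssubset he) C hv) (hstep S C e he hsafe)
  · have hns : ∀ e ∈ S, v ∈ cluster ends (withC (insert e C) (fun _ => false)) s := by
      intro e he
      by_contra hc
      exact h ⟨e, he, hc⟩
    exact typedCount_nonneg_of_no_safe ends s v hF hG S C hv hns

omit [Fintype E] in
/-- With no contracted edge the `C`-cluster of `s` is `{s}`. -/
lemma cclus_empty (ends : E → Sym2 V) (s : V) : cclus ends (∅ : Finset E) s = {s} := by
  apply Set.Subset.antisymm
  · refine cluster_subset_of_closed (Set.mem_singleton s) ?_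
    intro e x y he _ _
    simp [withC_apply] at he
  · intro u hu
    rw [Set.mem_singleton_iff] at hu
    subst hu
    exact mem_cluster_self _ _ _

/-- **Corollary**: the step at safe edges gives the typed point-split count `T(S, ∅) ≥ 0` for every
edge set `S`, for `v ≠ s`. -/
theorem typedCount_empty_nonneg_of_step (ends : E → Sym2 V) {s v : V} (hsv : v ≠ s)
    {F G : Set V → R} (hF : Monotone F) (hG : Monotone G)
    (hstep : ∀ (S C : Finset E) (e : E), e ∈ S →
      v ∉ cluster ends (withC (insert e C) (fun _ => false)) s →
      typedCount ends s v F G (S.erase e) C ≤ typedCount ends s v F G S C)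
    (S : Finset E) : 0 ≤ typedCount ends s v F G S ∅ :=
  typedCount_nonneg_of_step ends s v hF hG hstep S ∅ (by
    rw [cclus_empty]
    exact hsv)

end Induction


end TypedDeletion

end Summit.Ventures.PercRepro2
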